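import Summits.Ventures.CertifiedManyBodySolver.Observables.BraggWeightWiener
import HarnessLib

/-!
# Finite-box Fejér ceilings: every windowed structure factor per site bounds the Bragg weight from above

HONEST FRAMING: first certified bounds on pairing observables; not a superconductivity verdict; every number
certified or labelled float.  Pure harmonic analysis; zero compute; no state, no named fact, no sorry.

Cell hubbard-obs (D-0042 crew 1), seat hubbard-obs-p3 (controls: density / spin structure factors), on top of the
mbsolver cell's `Observables/BraggWeightWiener.lean` (seat sr-mbsolver-m3-4): there Wiener's lemma says that the
box structure-factor means `boxPairMean C Q M = M^{-2d} Σ_{x,y ∈ {0,…,M-1}ᵈ} e^{-i(x−y)·Q} C(x − y)` of a lattice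
function `C` represented by a finite measure `μ` (`∫ e^{i r·ξ} dμ = C r`, Herglotz) CONVERGE to the Bragg weight
`braggWeight μ ![Q] = μ(Q + 2πℤᵈ)` as `M → ∞`.  This file adds the one-line quantitative half that the certified
rows use: the convergence is FROM ABOVE in the sense that EVERY finite box already dominates the limit,

  `braggWeight μ ![Q] ≤ Re (boxPairMean C Q M)`   for every `M ≠ 0` and every wavevector `Q ∈ ℝᵈ`

(`braggWeight_single_le_re_boxPairMean`).  Proof: `boxPairMean C Q M = ∫ |K_M|² dμ` with the product Dirichlet
kernel `K_M(ξ) = Π_i D_M(ξ_i − Q_i)` (`boxPairMean_eq_integral`, m3-4), `|K_M| ≤ 1` everywhere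
(`norm_boxKernel_le_one`) and `K_M = 1` on `Q + 2πℤᵈ` (`boxKernel_eq_one_of_mem_braggSet`, here); so
`μ(Q + 2πℤᵈ) = ∫_{Q+2πℤᵈ} |K_M|² dμ ≤ ∫ |K_M|² dμ`.

Consequences (why the controls seat wants it).  For a translation-invariant state `ω` on `ℤ²` and a one-site
observable `a`, `C(r) = ω(a⋆ τ_r a)` is positive definite (`IsTranslationInvariant.isPositiveDefinite_corr`, tree),
so a representing `μ` exists and the squared long-range-order parameter at ANY wavevector `Q` — commensurate or
not — is bounded by ONE finite window sum of two-point functions, the structure factor per site of an `M × M`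
box, with no kernel to design and no nonnegativity to prove case by case (compare the hand-built cosine kernels of
`Observables/StripeOrderKernels.lean`, which remain the sharper tool when a tuned kernel is available):
`Q = 0`, spin channel: the ferromagnetic (uniform-magnetisation) Bragg weight is at most `⟨(Σ_{x∈B} 𝐒_x)²⟩/|B|²`;
`Q = 0`, connected density channel: the phase-separation amplitude (Bragg weight of the density fluctuation at
`q = 0`) is at most `Var(N_B)/|B|²`; `Q = (π,π)`: the Néel weight is at most the staggered box sum; the stripe
arms `(π/4, 0)`, `(7π/8, π)` likewise.  Each right-hand side is an exact ℚ-linear (for commensurate `Q`) or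
real-linear combination of the per-displacement correlators that the cell's energy-capped moment relaxations
bound (`Rows/DopedTLCorr.lean` row predicates), so a certified UPPER row on the box sum is a certified ceiling on
the Bragg weight.  A ceiling says nothing about the presence of order.

Also recorded: `re_boxPairMean_eq_integral` (the mean is the integral of `|K_M|²`, hence real and `≥ 0`,
`re_boxPairMean_nonneg`), the positive-definiteness-keyed form `boxCeiling_of_isPositiveDefinite` (a representing
measure EXISTS and every representing measure obeys the ceiling; non-vacuity as in
`kernelCeiling_of_isPositiveDefinite`), and `braggWeight_single_le_re_zero` (the trivial `M = 1` instance: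
`μ(Q + 2πℤᵈ) ≤ Re C(0)`).

References: Katznelson, *An Introduction to Harmonic Analysis*, I.7 (Wiener); Hirsch, PRB 31 (1985) 4403,
eq. (4.7) (structure factor per site).  [folklore]
-/

noncomputable section

namespace Summit.Ventures.CertifiedManyBodySolver.Observables

open MeasureTheory Complex Filter Topology
open scoped Real BigOperators

section BoxCeiling

variable {d : ℕ}

/-- On the Bragg set `Q + 2πℤᵈ` the product Dirichlet kernel equals `1` (every factor `D_M(2πm) = 1`),
for `M ≠ 0`. [folklore] -/
theorem boxKernel_eq_one_of_mem_braggSet (Q : Fin d → ℝ) {M : ℕ} (hM : M ≠ 0)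
    {ξ : EuclideanSpace ℝ (Fin d)} (hξ : ξ ∈ braggSet Q) : boxKernel Q M ξ = 1 := by
  obtain ⟨m, hm⟩ := hξ
  have h1 : ∀ i, exp (((ξ i - Q i : ℝ) : ℂ) * I) = 1 := fun i =>
    (exp_ofReal_mul_I_eq_one_iff _).mpr ⟨m i, by rw [hm i]; ring⟩
  unfold boxKernel
  exact Finset.prod_eq_one fun i _ => dirichletMean_eq_one (h1 i) hM

variable {C : (Fin d → ℤ) → ℂ} (μ : Measure (EuclideanSpace ℝ (Fin d))) [IsFiniteMeasure μ]

/-- `|K_M|²` is integrable against a finite measure (it is continuous and bounded by `1`). -/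
theorem integrable_norm_boxKernel_sq (Q : Fin d → ℝ) (M : ℕ) :
    Integrable (fun ξ : EuclideanSpace ℝ (Fin d) => ‖boxKernel Q M ξ‖ ^ 2) μ := by
  refine Integrable.mono' (integrable_const (1 : ℝ))
    ((continuous_boxKernel Q M).norm.pow 2).aestronglyMeasurable (ae_of_all _ fun ξ => ?_)
  rw [Real.norm_eq_abs, abs_pow, abs_norm]
  exact pow_le_one₀ (norm_nonneg _) (norm_boxKernel_le_one Q M ξ)

/-- The structure-factor mean of a represented `C` is the integral of `|K_M|²`; in particular it is real:
`Re (boxPairMean C Q M) = ∫ |K_M|² dμ`. [folklore] -/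
theorem re_boxPairMean_eq_integral
    (hμ : ∀ r : Fin d → ℤ, ∫ ξ, exp ((∑ i, (r i : ℝ) * ξ i : ℝ) * I) ∂μ = C r)
    (Q : Fin d → ℝ) (M : ℕ) :
    (boxPairMean C Q M).re = ∫ ξ, ‖boxKernel Q M ξ‖ ^ 2 ∂μ := by
  rw [boxPairMean_eq_integral μ hμ Q M, integral_complex_ofReal, Complex.ofReal_re]

/-- The structure-factor mean of a represented `C` has nonnegative real part (it is `∫ |K_M|² dμ`). [folklore] -/
theorem re_boxPairMean_nonneg
    (hμ : ∀ r : Fin d → ℤ, ∫ ξ, exp ((∑ i, (r i : ℝ) * ξ i : ℝ) * I) ∂μ = C r)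
    (Q : Fin d → ℝ) (M : ℕ) :
    0 ≤ (boxPairMean C Q M).re := by
  rw [re_boxPairMean_eq_integral μ hμ Q M]
  exact integral_nonneg fun ξ => by positivity

/-- **Finite-box Fejér ceiling on a Bragg weight.**  For every finite measure `μ` representing the lattice
function `C` (`∫ e^{i r·ξ} dμ = C r`), every wavevector `Q ∈ ℝᵈ` and every box side `M ≠ 0`:
`braggWeight μ ![Q] = μ(Q + 2πℤᵈ) ≤ Re (M^{-2d} Σ_{x,y ∈ {0,…,M-1}ᵈ} e^{-i(x−y)·Q} C(x − y))` — the structure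
factor per site of ANY finite box is an upper bound on the squared order parameter at `Q`.
(`∫_{Q+2πℤᵈ} |K_M|² = μ(Q+2πℤᵈ)` since `K_M = 1` there; `≤ ∫ |K_M|²` since `|K_M|² ≥ 0`.) [folklore] -/
theorem braggWeight_single_le_re_boxPairMean
    (hμ : ∀ r : Fin d → ℤ, ∫ ξ, exp ((∑ i, (r i : ℝ) * ξ i : ℝ) * I) ∂μ = C r)
    (Q : Fin d → ℝ) {M : ℕ} (hM : M ≠ 0) :
    braggWeight μ ![Q] ≤ (boxPairMean C Q M).re := by
  rw [braggWeight_single, re_boxPairMean_eq_integral μ hμ Q M]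
  calc μ.real (braggSet Q)
      = ∫ ξ in braggSet Q, (1 : ℝ) ∂μ := by rw [setIntegral_const, smul_eq_mul, mul_one]
    _ = ∫ ξ in braggSet Q, ‖boxKernel Q M ξ‖ ^ 2 ∂μ :=
        setIntegral_congr_fun (measurableSet_braggSet Q) fun ξ hξ => by
          rw [boxKernel_eq_one_of_mem_braggSet Q hM hξ, norm_one, one_pow]
    _ ≤ ∫ ξ, ‖boxKernel Q M ξ‖ ^ 2 ∂μ :=
        setIntegral_le_integral (integrable_norm_boxKernel_sq μ Q M) (ae_of_all _ fun ξ => by positivity)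

omit [IsFiniteMeasure μ] in
/-- The `M = 1` instance is the trivial ceiling `μ(Q + 2πℤᵈ) ≤ Re C(0)` (total mass); recorded for
comparison (`braggWeight_le_re_zero` of `StripeOrderKernels` is the same fact for stars). [folklore] -/
theorem braggWeight_single_le_re_zero [IsFiniteMeasure μ]
    (hμ : ∀ r : Fin d → ℤ, ∫ ξ, exp ((∑ i, (r i : ℝ) * ξ i : ℝ) * I) ∂μ = C r) (Q : Fin d → ℝ) :
    braggWeight μ ![Q] ≤ (C 0).re :=
  braggWeight_le_re_zero μ hμ ![Q]

/-- **The ceiling keyed on positive-definiteness (non-vacuity + bound).**  For a positive-definite lattice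
function `C` a finite representing measure EXISTS (Herglotz), and EVERY representing measure obeys the
finite-box ceiling at every `Q` and every `M ≠ 0`.  With `C` = the (orbit-mean) two-point function of a
translation-invariant state (`IsTranslationInvariant.isPositiveDefinite_corr`) this is the form a certified
upper row on a box structure-factor sum is read through. [folklore] -/
theorem boxCeiling_of_isPositiveDefinite {C : (Fin d → ℤ) → ℂ}
    (hC : Literature.Analysis.FunctionSpaces.IsPositiveDefinite C) (Q : Fin d → ℝ) {M : ℕ} (hM : M ≠ 0) :
    (∃ μ : Measure (EuclideanSpace ℝ (Fin d)), IsFiniteMeasure μ ∧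
      ∀ r : Fin d → ℤ, ∫ ξ, exp ((∑ i, (r i : ℝ) * ξ i : ℝ) * I) ∂μ = C r) ∧
    ∀ μ : Measure (EuclideanSpace ℝ (Fin d)), IsFiniteMeasure μ →
      (∀ r : Fin d → ℤ, ∫ ξ, exp ((∑ i, (r i : ℝ) * ξ i : ℝ) * I) ∂μ = C r) →
      braggWeight μ ![Q] ≤ (boxPairMean C Q M).re :=
  ⟨hC.exists_measure_integral_exp_eq, fun μ _ hμ => braggWeight_single_le_re_boxPairMean μ hμ Q hM⟩


/-! ### The `Q = 0` instance in window form (uniform / `q = 0` Bragg weight ≤ box-averaged two-point sum) -/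

/-- At `Q = 0` all phases are `1`: `boxPairMean C 0 M = M^{-2d} Σ_{x,y ∈ box} C(x − y)`. [folklore] -/
theorem boxPairMean_zero (C : (Fin d → ℤ) → ℂ) (M : ℕ) :
    boxPairMean C 0 M = (∑ x ∈ Fintype.piFinset (fun _ : Fin d => Finset.range M),
      ∑ y ∈ Fintype.piFinset (fun _ : Fin d => Finset.range M), C (fun i => (x i : ℤ) - y i)) / (M : ℂ) ^ (2 * d) := by
  unfold boxPairMean
  congr 1
  refine Finset.sum_congr rfl fun x _ => Finset.sum_congr rfl fun y _ => ?_
  simp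

/-- **`q = 0` box ceiling in window form.**  For every finite measure `μ` representing `C` and every `M ≠ 0`:
`braggWeight μ ![0] ≤ M^{-2d} Σ_{x,y ∈ {0,…,M-1}ᵈ} Re C(x − y)` — e.g. with `C(r) = ω(𝐒₀·𝐒_r)` (spin channel) the
squared uniform magnetisation of a translation-invariant state is at most `⟨(Σ_{x∈B} 𝐒_x)²⟩/|B|²` for every box
`B`, and with the connected density two-point function the `q = 0` density-fluctuation weight (phase-separation
amplitude) is at most `Var(N_B)/|B|²`.  A ceiling; it says nothing about the presence of order. [folklore] -/
theorem braggWeight_zero_le_boxSum_re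
    (hμ : ∀ r : Fin d → ℤ, ∫ ξ, exp ((∑ i, (r i : ℝ) * ξ i : ℝ) * I) ∂μ = C r) {M : ℕ} (hM : M ≠ 0) :
    braggWeight μ ![(0 : Fin d → ℝ)] ≤ (∑ x ∈ Fintype.piFinset (fun _ : Fin d => Finset.range M),
      ∑ y ∈ Fintype.piFinset (fun _ : Fin d => Finset.range M), (C (fun i => (x i : ℤ) - y i)).re)
        / (M : ℝ) ^ (2 * d) := by
  have h := braggWeight_single_le_re_boxPairMean μ hμ (0 : Fin d → ℝ) hM
  rw [boxPairMean_zero, ← Nat.cast_pow, Complex.div_natCast_re, Complex.re_sum, Nat.cast_pow] at h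
  simpa only [Complex.re_sum] using h

end BoxCeiling

end Summit.Ventures.CertifiedManyBodySolver.Observables

end
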